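import Summits.ABC.IUTFork.Joshi.ATS4DescentSpineGenuineResidualUnsat
import Summits.ABC.IUTFork.Joshi.ATS4DescentSpineGenuineResidualUnsatReading3
import Summits.ABC.IUTFork.Joshi.ATS4DescentSpineAbcThetaDivision
import HarnessLib

/-!
# [J-IV] (arXiv:2403.10430v2) §6.10–§7.1, E5 descent spine: the GENUINE-COMPONENT residual of `abc_of_genuineResidualSupport`
# is INHABITED at the LOW S-unit points `P_{a,c}` (vol ≡ 0) — the positive half of the Y-21 PARENT small print (r1)

Proof-only companion (0 defs) of the abc-iut cell, sub-cell R-J «JOSHI Y-DISCHARGE CENSUS» (rung LADDER-ABC:A2.RESCUE.J; table of record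
`HOME/plan/E/R-J/Y-CENSUS.tsv`, row Y-21 PARENT), seat abc-iut-E-t33 (gen 7; lineage = the author of the binder, p464392
`Joshi/ATS4DescentSpineGenuineResidual.lean`, + p464845 / p454744 / p455547 / p440771 / p437546). The census word v1.35/v1.36 (E-plan
01:24:51Z / 01:34:44Z) records E-t35 g9's KERNEL KILL (p479649 / p480406 / p480909): at the tree's S-unit points `P_{a,c} =
(ℚ(√(5^{2a}+4·7^{2c})), θ/7^c)` with `a ≥ 10⁸`, `7^c ≤ 5^a`, `d = 2`, every prime `ℓ ≥ 7`, the `∃`-body of the binder of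
`abc_of_genuineResidualSupport` is UNSATISFIABLE (`SUnitResidual.genuineResidualSupport_unsat`), hence that hypothesis is FALSE. Its small
print (r1) (lane 1, E-cx g6 01:24:34Z, adopted v1.36) reads: «the ∃-body is NOT shown unsatisfiable at every admissible triple and need
not be — where every bad prime's share `q_p/6` stays below the Step-(v) slack, `vol ≡ 0`, `vol_∞ = 0` satisfies StepV ∧ Lower …; no
satisfying admissible triple is exhibited in kernel either». THIS FILE is the KERNEL form of that positive half, on the SAME family:

* `SUnitResidual.residueChar_eq_five_or_seven_of_mem_V`, `.qComp_eq_zero`, `.qComp_le` — over every finite `M ⊇ F_{a,c}` the support of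
  Joshi's Tate divisor `𝔮_M` (away from any `S`) lies over `5` and `7` only (`SUnitFamily.five_mem_or_seven_mem_of_ord_neg` through
  `TateDivisorDatum.mem_ofNFPointOver_V_iff`), so the GENUINE `p`-component of `log(q)` VANISHES at `p ∉ {5, 7}` and is `≤ log 𝔮_M =
  a·log 5 + 2c·log 7` (`logq_ofNFPointOver_eq_logQAvoid`, `SUnitFamily.logQAvoid_le`) at `p ∈ {5, 7}`;
* `SUnitResidual.slack_arith` — a `q`-share `≤ 5·10⁶/6` sits under Prop. 6.10.9's Mertens term `(20/3)·e*_mod·(log p)/p` at `p ∈ {5, 7}`;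
* **`SUnitResidual.genuineResidual_reading3_sat`** and **`SUnitResidual.genuineResidualSupport_sat`** — for `1 ≤ a`, `1 ≤ c`,
  **`a + 2c ≤ 2.5·10⁶`** (so `a·log 5 + 2c·log 7 < 5·10⁶`) and EVERY prime `ℓ ≥ 7`, the `∃`-bodies of the binders of
  `abc_of_genuineResidual_reading3` (p464392 §5) and of `abc_of_genuineResidualSupport` (p464392 §4) at `(d, P) := (2, Pt a c)` — the
  latter byte-identical to the body negated in E-t35's `genuineResidualSupport_unsat` (p480406 l.124–151) — are INHABITED, witnesses BY
  NAME: the tower `F ⊆ K`, `ψK = F(E_F[ℓ])` of `exists_thetaField_divisionField` ([IUTchI] Def. 3.1 (c)), `0 < log 𝔮_F` ⟸ (P5)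
  (`logq_ofNFPointOver_pos_iff_condP5`, `SUnitFamily.condP5_P`), `L_mod := F_{a,c}` (`dmod_le_of_mem_UPle`), `V^dst_ℚ :=` the reading-(3)
  set with its three binders discharged exactly as in p464392 §5 (`GenuineVdst.*`), `D_K := Supp(𝔡_K)`, and **`vol ≡ 0`, `vol_∞ = 0`**:
  Step (v) per prime reads `0 ≤ RHS_p` (genuine `d_p ≥ 0`, `log p ≥ 0`, and the `q`-share under the Mertens slack), the lower bound
  reads `−(1/2ℓ)·log 𝔮_F ≤ 0`;
* `SUnitResidual.admissible_except_P6` — at `(a, c, ℓ) = (1, 1, 17)` EVERY admissibility clause of the binder except (P6) holds in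
  kernel: `P_{1,1} ∈ U(Q̄)_{≤2}`, `IsLem587Prime 2 P_{1,1} 17` (window by `SUnitFamily.logQForall_eq`: `log q^∀ = log 5 + 2·log 7`; (P2)
  `condP2_P`; the residue-`ℓ` clause vacuous), `7 ≤ ℓ`, (P2), (P5), `AdmitsCore`, the Lemma-6.7.8 room. (P6) = `Cor22.CondP6` (Galois
  image `⊇ SL₂(𝔽_ℓ)`) is discharged by the tree ONLY above the INEFFECTIVE height `H_K` of `Cor22.condP6_of_seven_le`; it is NOT claimed here.

READING (two-sided with E-t35's kill; no count effect): the located countermodel of the Y-21 PARENT word is a HEIGHT THRESHOLD inside ONE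
family — `∃`-body INHABITED for `a + 2c ≤ 2.5·10⁶`, UNINHABITED for `a ≥ 10⁸` (`7^c ≤ 5^a`) — sitting at Prop. 6.10.9's Mertens term
`(20/3)·e*_mod·ι_p·(log p)/p` versus the growth of the single-prime share `q₅ = a·log 5`; the typed residual is not degenerate. (r1)'s last
clause becomes: «a satisfying triple IS exhibited in kernel for the `∃`-body — `(2, P_{a,c}, ℓ)`, `a + 2c ≤ 2.5·10⁶`, every prime `ℓ ≥ 7`; every
admissibility clause but (P6) holds at `(1, 1, 17)`; (P6) is available in the tree only above an ineffective height — located, not claimed».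

SOURCE locators: [J-IV] Prop. 6.10.9 p.69 l.1–28 ([IUTchIV] Step (v) per `v_ℚ ∈ V^dst_ℚ`, the term «(20/3)·e*_mod·ι_{v_ℚ}·log(p_{v_ℚ})/p_{v_ℚ}»),
(6.11.1) p.69 l.73–p.70 l.3, p.70 l.4–29, Lemma 5.8.7 p.56 l.33–44, Thm. 5.7.1 p.53 l.31–46 (render `HOME/lit/renders/Joshi-arxiv-2403.10430/`);
[IUTchIV] Thm. 1.10 Step (v) pp.27–28, Cor. 2.2 (ii) (P1)–(P7) pp.45–46, [IUTchI] Def. 3.1 (c) p.62 (kurims). FRAMING (binding): a located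
NON-VACUITY datum about OUR typed carrier of the E5 residual AS PRINTED with (6.11.1)'s `Σ|·|` convention — not a statement about any author's
theorem; NO side taken on [IUTchIII] Cor. 3.12 / [IUTchIV] Thm. 1.10, on Joshi's claims or on Mochizuki's report on them; NOT an abc claim (the
parent implications stay VACUOUS by E-t35's kill of their `∀`-hypotheses); typed ≠ proved ≠ endorsed. Theorems only; standard axioms; FACT rows
none. [claim: Joshi2024ATS4, status: disputed].
-/

noncomputable section

namespace Summit.ABC.IUTFork.Joshi.ATS4

open NumberField IsDedekindDomain Finset
open Literature.IUT.LogVolume Literature.IUT.LogVolume.Cor22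
open Literature.NumberTheory.DiophantineGeometry Literature.NumberTheory.DiophantineGeometry.GenEll
open Literature.NumberTheory.EllipticCurves
open Summit.ABC.IUTFork.SUnitFamily
open scoped Classical

namespace SUnitResidual

/-! ## 1. Real arithmetic: the Mertens slack of Prop. 6.10.9 at `p ∈ {5, 7}` -/

/-- `(log 5)/5 ≥ 0.259` (`log 5 ≥ 2·log 2`). [folklore] -/
theorem log_five_div_ge : (0.259 : ℝ) ≤ Real.log 5 / 5 := by
  have h2 := Real.log_two_gt_d9
  have h : 2 * Real.log 2 ≤ Real.log 5 := by
    rw [← Real.log_rpow (by norm_num), Real.rpow_two]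
    exact Real.log_le_log (by norm_num) (by norm_num)
  linarith

/-- `(log 7)/7 ≥ 0.259` (`log 7 = 2·log 2 + log(7/4) ≥ 2·log 2 + (1 − 4/7)`). [folklore] -/
theorem log_seven_div_ge : (0.259 : ℝ) ≤ Real.log 7 / 7 := by
  have h2 := Real.log_two_gt_d9
  have h74 : 1 - (7 / 4 : ℝ)⁻¹ ≤ Real.log (7 / 4) := Real.one_sub_inv_le_log_of_pos (by norm_num)
  have h : Real.log 7 = 2 * Real.log 2 + Real.log (7 / 4) := by
    rw [← Real.log_rpow (by norm_num), Real.rpow_two, ← Real.log_mul (by norm_num) (by norm_num)]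
    norm_num
  rw [h]
  norm_num at h74 ⊢
  linarith

/-- **The slack inequality**: a `q`-share `q ≤ 5·10⁶` satisfies `q/6 ≤ (20/3)·E·ι` once `E ≥ 552960` and `ι ≥ 0.259`
(`(20/3)·552960·0.259 = 954777.6 ≥ 833333.4`). [folklore] -/
theorem slack_arith {E ι q : ℝ} (hE : 552960 ≤ E) (hι : 0.259 ≤ ι) (hq : q ≤ 5000000) :
    1 / 6 * q ≤ 20 / 3 * E * ι := by
  have hι0 : 0 ≤ ι := le_trans (by norm_num) hι
  have h1 : (552960 : ℝ) * 0.259 ≤ E * ι := mul_le_mul hE hι (by norm_num) (by linarith)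
  nlinarith

/-! ## 2. The genuine `q`-components over the S-unit points `P_{a,c}`: zero off `{5, 7}`, at most `log 𝔮_M` on `{5, 7}` -/

variable {a c : ℕ} (ha : 1 ≤ a) (hc : 1 ≤ c)
include ha hc

omit ha in
/-- **`Supp(𝔮_M)` lies over `5` and `7` only**: for every finite `M ⊇ F_{a,c}` and every `S`, a place of Joshi's `V^{odd,ss}_M` (away from `S`)
has residue characteristic `5` or `7` (it lies over a pole of `j(λ_{a,c})`, and the poles lie over `5`, `7`).
[cite: Mochizuki2012, IUTchIV Cor 2.2 (ii) proof (P5) p.46] -/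
theorem residueChar_eq_five_or_seven_of_mem_V (S : Finset ℕ) (M : Type) [Field M] [NumberField M] [Algebra (Pt a c).F M]
    {w : HeightOneSpectrum (𝓞 M)} (hw : w ∈ (TateDivisorDatum.ofNFPointOver (Pt a c) S M).V) :
    residueChar M w = 5 ∨ residueChar M w = 7 := by
  haveI : Fact (Nat.Prime 5) := ⟨by norm_num⟩
  haveI : Fact (Nat.Prime 7) := ⟨by norm_num⟩
  rw [TateDivisorDatum.mem_ofNFPointOver_V_iff] at hw
  have hbad := ((TateDivisorDatum.mem_ofNFPoint_V (Pt a c) S _).mp hw).1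
  have hneg : ord (SUnitFamily.F a c) (finBelow (SUnitFamily.F a c) M w) (jInv (lam a c)) < 0 :=
    (mem_badPlaces_iff_ord_neg (Pt a c) _).mp hbad
  rw [← residueChar_finBelow (F := SUnitFamily.F a c) w]
  rcases five_mem_or_seven_mem_of_ord_neg hc hneg with h | h
  · exact Or.inl ((mem_placesOver_iff_residueChar _).mp (mem_placesOver_of_natCast_mem 5 _ h))
  · exact Or.inr ((mem_placesOver_iff_residueChar _).mp (mem_placesOver_of_natCast_mem 7 _ h))

omit ha in
/-- **The genuine `p`-component of `log(q)` VANISHES at `p ∉ {5, 7}`** over every finite `M ⊇ F_{a,c}` (empty fibre).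
[cite: Mochizuki2012, IUTchIV Thm. 1.10 p. 23] -/
theorem qComp_eq_zero (S : Finset ℕ) (M : Type) [Field M] [NumberField M] [Algebra (Pt a c).F M] {p : ℕ} (hp5 : p ≠ 5)
    (hp7 : p ≠ 7) :
    (Module.finrank ℚ M : ℝ)⁻¹ *
      ∑ w ∈ (TateDivisorDatum.ofNFPointOver (Pt a c) S M).V with residueChar M w = p,
        (TateDivisorDatum.ofNFPointOver (Pt a c) S M).tateDivisor (Sum.inr w) * logNorm M w = 0 := by
  rw [Finset.sum_eq_zero, mul_zero]
  intro w hw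
  obtain ⟨hwV, hres⟩ := Finset.mem_filter.mp hw
  exfalso
  rcases residueChar_eq_five_or_seven_of_mem_V hc S M hwV with h | h <;> omega

/-- **The genuine `p`-component of `log(q)` is at most `log 𝔮_M = log q^{∤S}(λ_{a,c}) ≤ a·log 5 + 2c·log 7`** (a sub-sum of the
nonnegative sum (4.4.5); Prop. 4.4.4 `logq_ofNFPointOver_eq_logQAvoid`; `SUnitFamily.logQAvoid_le`). [cite: Mochizuki2012, IUTchIV Def. 1.9 (i) p. 22] -/
theorem qComp_le (S : Finset ℕ) (M : Type) [Field M] [NumberField M] [Algebra (Pt a c).F M] (p : ℕ) :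
    (Module.finrank ℚ M : ℝ)⁻¹ *
      ∑ w ∈ (TateDivisorDatum.ofNFPointOver (Pt a c) S M).V with residueChar M w = p,
        (TateDivisorDatum.ofNFPointOver (Pt a c) S M).tateDivisor (Sum.inr w) * logNorm M w ≤
      a * Real.log 5 + 2 * c * Real.log 7 := by
  set 𝔮 := TateDivisorDatum.ofNFPointOver (Pt a c) S M with h𝔮
  have hMpos : (0 : ℝ) < Module.finrank ℚ M := by exact_mod_cast Module.finrank_pos
  have hnn : ∀ w ∈ 𝔮.V, 0 ≤ 𝔮.tateDivisor (Sum.inr w) * logNorm M w := fun w _ =>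
    mul_nonneg (𝔮.tateDivisor_isEffective _) (logNorm_pos M w).le
  have hsub := Finset.sum_le_sum_of_subset_of_nonneg (Finset.filter_subset (fun w => residueChar M w = p) 𝔮.V)
    (f := fun w => 𝔮.tateDivisor (Sum.inr w) * logNorm M w) (fun w hw _ => hnn w hw)
  have hQ : 𝔮.logq ≤ a * Real.log 5 + 2 * c * Real.log 7 := by
    rw [h𝔮, TateDivisorDatum.logq_ofNFPointOver_eq_logQAvoid]
    exact logQAvoid_le ha hc S
  calc (Module.finrank ℚ M : ℝ)⁻¹ * ∑ w ∈ 𝔮.V with residueChar M w = p, 𝔮.tateDivisor (Sum.inr w) * logNorm M w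
      ≤ (Module.finrank ℚ M : ℝ)⁻¹ * ∑ w ∈ 𝔮.V, 𝔮.tateDivisor (Sum.inr w) * logNorm M w :=
        mul_le_mul_of_nonneg_left hsub (inv_nonneg.mpr hMpos.le)
    _ = (∑ w ∈ 𝔮.V, (𝔮.ordq w : ℝ) * logNorm M w) / Module.finrank ℚ M := by
        rw [div_eq_inv_mul]
        congr 1
        exact Finset.sum_congr rfl fun w hw => by rw [𝔮.tateDivisor_apply_inr, if_pos hw]
    _ = 𝔮.logq := 𝔮.logq_eq_sum.symm
    _ ≤ a * Real.log 5 + 2 * c * Real.log 7 := hQ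

/-! ## 3. THE POSITIVE CONTROL at the reading-(3) set: the `∃`-body of `abc_of_genuineResidual_reading3` (p464392 §5) is INHABITED -/

/-- **The GENUINE-COMPONENT residual of `abc_of_genuineResidual_reading3` (p464392 §5) is INHABITED at the S-unit point `P_{a,c}`, `d = 2`,
for `1 ≤ a`, `1 ≤ c`, `a + 2c ≤ 2.5·10⁶` and EVERY prime `ℓ ≥ 7`, with `vol ≡ 0`, `vol_∞ = 0`.** The body below is that theorem's
`∃`-body VERBATIM at `d := 2`, `P := Pt a c`. Witnesses: the theta field `F` and `K`, `ψK = F(E_F[ℓ])` (`exists_thetaField_divisionField`);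
`0 < log 𝔮_F` by (P5) (`SUnitFamily.condP5_P`); `L_mod := F_{a,c}` (`dmod_le_of_mem_UPle`); `D_K := Supp(𝔡_K)`; zero volumes. Step (v) at
`p ∈ primeFactors(30ℓ) ∪ p(Supp 𝔮_{F_{a,c}}) ∪ primeFactors(disc F_{a,c})` then reads `0 ≤ ((ℓ+1)/4)·((1+4/ℓ)·d_p − q_p/6 + (4/ℓ)·log p +
(20/3)·e*_mod·ι_p·(log p)/p)`: `d_p ≥ 0`; `q_p = 0` off `{5,7}` (`qComp_eq_zero`); on `{5,7}`, `ι_p = 1` and `q_p ≤ a·log 5 + 2c·log 7 < 5·10⁶`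
(`qComp_le`, `log 7 ≤ 2`) is absorbed by the Mertens term (`slack_arith`, `e*_mod ≥ 552960`). A located NON-VACUITY datum at OUR carrier; no
side taken on [IUTchIII] Cor. 3.12 / [IUTchIV] Thm. 1.10 or on any author; NOT an abc claim. [claim: Joshi2024ATS4, status: disputed] -/
theorem genuineResidual_reading3_sat (hsmall : a + 2 * c ≤ 2500000) {ℓ : ℕ} (hℓ : ℓ.Prime) (h7 : 7 ≤ ℓ) :
    ∃ (F : Type) (_ : Field F) (_ : NumberField F) (_ : Algebra (Pt a c).F F)
          (K : Type) (_ : Field K) (_ : NumberField K) (_ : Algebra F K) (_ : Algebra (Pt a c).F K)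
          (_ : IsScalarTower (Pt a c).F F K)
          (_ : IsGalois F K) (ψ : K →ₐ[F] AlgebraicClosure F) (hU : (Pt a c).InU) (_ : IsThetaField (Pt a c) F)
          (_ : letI := thetaCurve_isElliptic hU F
            ((thetaCurve (Pt a c) F).galoisRepTorsion (ℓ : ℤ)).ker ≤ ψ.fieldRange.fixingSubgroup)
          (_ : 0 < (TateDivisorDatum.ofNFPointOver (Pt a c) {2, ℓ} F).logq)
          (Lmod : Type) (_ : Field Lmod) (_ : NumberField Lmod) (_ : Cor22.dmod (Pt a c) ≤ dMod Lmod) (_ : dMod Lmod ≤ 2)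
          (DK : Finset (HeightOneSpectrum (𝓞 K))) (_ : ∀ u, differentDivisor K (Sum.inr u) ≠ 0 → u ∈ DK)
          (vol : ℕ → ℝ) (volArch : ℝ),
          (∀ p ∈ (2 * 3 * 5 * ℓ).primeFactors ∪ (TateDivisorDatum.ofNFPoint (Pt a c) {2, ℓ}).V.image (residueChar (Pt a c).F) ∪
              (discr (Pt a c).F).natAbs.primeFactors,
            -(1 / (((ℓ : ℝ) - 1) / 2)) * |vol p| ≤ ((ℓ : ℝ) + 1) / 4 *
            ((1 + 4 / (ℓ : ℝ)) *
                ((Module.finrank ℚ K : ℝ)⁻¹ *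
                  ∑ u ∈ DK with residueChar K u = p, differentDivisor K (Sum.inr u) * logNorm K u)
              - 1 / 6 *
                ((Module.finrank ℚ F : ℝ)⁻¹ *
                  ∑ w ∈ (TateDivisorDatum.ofNFPointOver (Pt a c) {2, ℓ} F).V with residueChar F w = p,
                    (TateDivisorDatum.ofNFPointOver (Pt a c) {2, ℓ} F).tateDivisor (Sum.inr w) * logNorm F w)
              + 4 / (ℓ : ℝ) * Real.log p
              + 20 / 3 * ((2 ^ 12 * 3 ^ 3 * 5 * eMod Lmod : ℕ) : ℝ) *
                (if p ≤ 2 ^ 12 * 3 ^ 3 * 5 * eMod Lmod * ℓ then Real.log p / p else 0))) ∧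
          -(1 / (2 * (ℓ : ℝ)) * (TateDivisorDatum.ofNFPointOver (Pt a c) {2, ℓ} F).logq) ≤
            -(1 / (((ℓ : ℝ) - 1) / 2)) *
              (∑ p ∈ (2 * 3 * 5 * ℓ).primeFactors ∪ (TateDivisorDatum.ofNFPoint (Pt a c) {2, ℓ}).V.image (residueChar (Pt a c).F) ∪
                  (discr (Pt a c).F).natAbs.primeFactors, |vol p| + |volArch|) := by
  have hℓ5 : ℓ ≠ 5 := by omega
  have hP : Pt a c ∈ UP := P_mem_UP ha hc
  have hU : (Pt a c).InU := hP.1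
  have hPle : Pt a c ∈ UPle 2 := ⟨hP, (finrank_F a c).le⟩
  have hmod := dmod_le_of_mem_UPle hPle
  -- the genuine tower `F ⊆ K`, `ψK = F(E_F[ℓ])`
  obtain ⟨F, _, _, _, K, _, _, _, _, _, _, ψ, hF, -, hK⟩ := exists_thetaField_divisionField (P := Pt a c) hU hℓ
  have hq : 0 < (TateDivisorDatum.ofNFPointOver (Pt a c) {2, ℓ} F).logq :=
    (TateDivisorDatum.logq_ofNFPointOver_pos_iff_condP5 (Pt a c) ℓ F).mpr (condP5_P ha hc hℓ hℓ5)
  refine ⟨F, inferInstance, inferInstance, inferInstance, K, inferInstance, inferInstance, inferInstance, inferInstance,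
    inferInstance, inferInstance, ψ, hU, hF, hK, hq, (Pt a c).F, inferInstance, inferInstance, hmod.1, hmod.2,
    (differentDivisor K).support.preimage Sum.inr Sum.inr_injective.injOn,
    fun u hu => Finset.mem_preimage.mpr (Finsupp.mem_support_iff.mpr hu), fun _ => 0, 0, ?_, ?_⟩
  · -- Step (v) per prime with `vol ≡ 0`: `0 ≤ RHS_p`
    intro p hp
    have hℓpos : (0 : ℝ) < ℓ := by exact_mod_cast hℓ.pos
    have hlogp : 0 ≤ Real.log p := Real.log_natCast_nonneg p
    have hd : 0 ≤ (Module.finrank ℚ K : ℝ)⁻¹ *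
        ∑ u ∈ ((differentDivisor K).support.preimage Sum.inr Sum.inr_injective.injOn) with residueChar K u = p,
          differentDivisor K (Sum.inr u) * logNorm K u :=
      mul_nonneg (inv_nonneg.mpr (Nat.cast_nonneg _)) (Finset.sum_nonneg fun u _ => differentDivisor_mul_logNorm_nonneg K u)
    have hE1 : 1 ≤ eMod (Pt a c).F := one_le_eMod _
    have hE : (552960 : ℝ) ≤ ((2 ^ 12 * 3 ^ 3 * 5 * eMod (Pt a c).F : ℕ) : ℝ) := by
      have h1 : (1 : ℝ) ≤ (eMod (Pt a c).F : ℝ) := by exact_mod_cast hE1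
      push_cast
      linarith
    have hι0 : 0 ≤ (if p ≤ 2 ^ 12 * 3 ^ 3 * 5 * eMod (Pt a c).F * ℓ then Real.log p / p else 0) := by
      split_ifs
      · exact div_nonneg hlogp (Nat.cast_nonneg _)
      · exact le_rfl
    -- the `q`-share against the Mertens term
    have hkey : 1 / 6 * ((Module.finrank ℚ F : ℝ)⁻¹ *
          ∑ w ∈ (TateDivisorDatum.ofNFPointOver (Pt a c) {2, ℓ} F).V with residueChar F w = p,
            (TateDivisorDatum.ofNFPointOver (Pt a c) {2, ℓ} F).tateDivisor (Sum.inr w) * logNorm F w) ≤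
        20 / 3 * ((2 ^ 12 * 3 ^ 3 * 5 * eMod (Pt a c).F : ℕ) : ℝ) *
          (if p ≤ 2 ^ 12 * 3 ^ 3 * 5 * eMod (Pt a c).F * ℓ then Real.log p / p else 0) := by
      by_cases h57 : p = 5 ∨ p = 7
      · -- `ι_p = 1`, `q_p ≤ a·log 5 + 2c·log 7 < 5·10⁶`
        have hp7 : p ≤ 7 := by omega
        have hpι : p ≤ 2 ^ 12 * 3 ^ 3 * 5 * eMod (Pt a c).F * ℓ :=
          hp7.trans (h7.trans (Nat.le_mul_of_pos_left ℓ (by positivity)))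
        rw [if_pos hpι]
        have hQ := qComp_le ha hc {2, ℓ} F p
        have hsm : (a : ℝ) + 2 * c ≤ 2500000 := by exact_mod_cast hsmall
        have h5le : Real.log 5 ≤ Real.log 7 := Real.log_le_log (by norm_num) (by norm_num)
        have ha0 : (0 : ℝ) ≤ a := Nat.cast_nonneg a
        have hc0 : (0 : ℝ) ≤ c := Nat.cast_nonneg c
        have hl7 : Real.log 7 ≤ 2 := by
          rw [Real.log_le_iff_le_exp (by norm_num)]
          have he := Real.exp_one_gt_d9
          have e2 : Real.exp 2 = Real.exp 1 * Real.exp 1 := by rw [← Real.exp_add]; norm_num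
          rw [e2]; nlinarith
        have hQ' : (a : ℝ) * Real.log 5 + 2 * c * Real.log 7 ≤ 5000000 := by nlinarith
        refine slack_arith hE ?_ (hQ.trans hQ')
        rcases h57 with rfl | rfl
        · have e : ((5 : ℕ) : ℝ) = 5 := by norm_num
          rw [e]; exact log_five_div_ge
        · have e : ((7 : ℕ) : ℝ) = 7 := by norm_num
          rw [e]; exact log_seven_div_ge
      · push Not at h57
        rw [qComp_eq_zero hc {2, ℓ} F h57.1 h57.2, mul_zero]
        exact mul_nonneg (mul_nonneg (by norm_num) (Nat.cast_nonneg _)) hι0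
    have h1 : 0 ≤ (1 + 4 / (ℓ : ℝ)) * ((Module.finrank ℚ K : ℝ)⁻¹ *
        ∑ u ∈ ((differentDivisor K).support.preimage Sum.inr Sum.inr_injective.injOn) with residueChar K u = p,
          differentDivisor K (Sum.inr u) * logNorm K u) := mul_nonneg (by positivity) hd
    have h2 : 0 ≤ 4 / (ℓ : ℝ) * Real.log p := mul_nonneg (by positivity) hlogp
    have h3 : (0 : ℝ) ≤ ((ℓ : ℝ) + 1) / 4 := by positivity
    rw [abs_zero, mul_zero]
    exact mul_nonneg h3 (by linarith)
  · -- the lower bound with zero volumes: `−(1/2ℓ)·log 𝔮_F ≤ 0`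
    simp only [abs_zero, Finset.sum_const_zero, add_zero, mul_zero]
    have hℓpos : (0 : ℝ) < ℓ := by exact_mod_cast hℓ.pos
    have : 0 ≤ 1 / (2 * (ℓ : ℝ)) * (TateDivisorDatum.ofNFPointOver (Pt a c) {2, ℓ} F).logq := by positivity
    linarith

/-! ## 4. THE POSITIVE CONTROL, support form: the `∃`-body of `abc_of_genuineResidualSupport` (p464392 §4) is INHABITED -/

/-- **The GENUINE-COMPONENT residual (R4′) ∧ (R5) of `abc_of_genuineResidualSupport` (p464392 §4) is INHABITED at the S-unit point
`P_{a,c}` (`1 ≤ a`, `1 ≤ c`, `a + 2c ≤ 2.5·10⁶`), `d = 2`, for EVERY prime `ℓ ≥ 7`, with `vol ≡ 0`, `vol_∞ = 0`.** The body below is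
that theorem's `∃`-body VERBATIM at `d := 2`, `P := Pt a c` — byte-for-byte the body NEGATED in E-t35's `genuineResidualSupport_unsat`
(p480406 l.124–151, there for `a ≥ 10⁸`, `7^c ≤ 5^a`): TOGETHER they locate the Y-21 PARENT countermodel as a HEIGHT THRESHOLD in ONE
family (inhabited for `a + 2c ≤ 2.5·10⁶`, uninhabited for `a ≥ 10⁸`). Witnesses: those of `genuineResidual_reading3_sat` with
`V^dst_ℚ :=` the reading-(3) set, admissible by p464392 §5's passage BY NAME (`GenuineVdst.prime_of_mem_reading3` /
`threeWay_of_mem_reading3` / `residueChar_mem_of_ramified` / `hsupp_ofNFPoint_pair`, `TateDivisorDatum.mem_ofNFPointOver_V_iff`). This does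
NOT touch the parent implications (their `∀`-hypotheses stay FALSE by p480406 / p480909); a located NON-VACUITY datum at OUR carrier; no
side taken on [IUTchIII] Cor. 3.12 / [IUTchIV] Thm. 1.10 or on any author; NOT an abc claim. [claim: Joshi2024ATS4, status: disputed] -/
theorem genuineResidualSupport_sat (hsmall : a + 2 * c ≤ 2500000) {ℓ : ℕ} (hℓ : ℓ.Prime) (h7 : 7 ≤ ℓ) :
    ∃ (F : Type) (_ : Field F) (_ : NumberField F) (_ : Algebra (Pt a c).F F)
          (K : Type) (_ : Field K) (_ : NumberField K) (_ : Algebra F K) (_ : Algebra (Pt a c).F K)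
          (_ : IsScalarTower (Pt a c).F F K)
          (_ : IsGalois F K) (ψ : K →ₐ[F] AlgebraicClosure F) (hU : (Pt a c).InU) (_ : IsThetaField (Pt a c) F)
          (_ : letI := thetaCurve_isElliptic hU F
            ((thetaCurve (Pt a c) F).galoisRepTorsion (ℓ : ℤ)).ker ≤ ψ.fieldRange.fixingSubgroup)
          (_ : 0 < (TateDivisorDatum.ofNFPointOver (Pt a c) {2, ℓ} F).logq)
          (Lmod : Type) (_ : Field Lmod) (_ : NumberField Lmod) (_ : Cor22.dmod (Pt a c) ≤ dMod Lmod) (_ : dMod Lmod ≤ 2)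
          (V : Finset ℕ)
          (_ : ∀ q ∈ V, q.Prime ∧ (q ∣ 2 * 3 * 5 * ℓ ∨ (∃ v ∈ badPlacesAvoid (Pt a c) {2, ℓ}, residueChar (Pt a c).F v = q) ∨
            ∃ u : HeightOneSpectrum (𝓞 K), residueChar K u = q ∧ 2 ≤ u.asIdeal.ramificationIdx ℤ))
          (_ : ∀ u : HeightOneSpectrum (𝓞 K), 2 ≤ u.asIdeal.ramificationIdx ℤ → residueChar K u ∈ V)
          (_ : ∀ w ∈ (TateDivisorDatum.ofNFPointOver (Pt a c) {2, ℓ} F).V, residueChar F w ∈ V)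
          (DK : Finset (HeightOneSpectrum (𝓞 K))) (_ : ∀ u, differentDivisor K (Sum.inr u) ≠ 0 → u ∈ DK)
          (vol : ℕ → ℝ) (volArch : ℝ),
          (∀ p ∈ V, -(1 / (((ℓ : ℝ) - 1) / 2)) * |vol p| ≤ ((ℓ : ℝ) + 1) / 4 *
            ((1 + 4 / (ℓ : ℝ)) *
                ((Module.finrank ℚ K : ℝ)⁻¹ *
                  ∑ u ∈ DK with residueChar K u = p, differentDivisor K (Sum.inr u) * logNorm K u)
              - 1 / 6 *
                ((Module.finrank ℚ F : ℝ)⁻¹ *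
                  ∑ w ∈ (TateDivisorDatum.ofNFPointOver (Pt a c) {2, ℓ} F).V with residueChar F w = p,
                    (TateDivisorDatum.ofNFPointOver (Pt a c) {2, ℓ} F).tateDivisor (Sum.inr w) * logNorm F w)
              + 4 / (ℓ : ℝ) * Real.log p
              + 20 / 3 * ((2 ^ 12 * 3 ^ 3 * 5 * eMod Lmod : ℕ) : ℝ) *
                (if p ≤ 2 ^ 12 * 3 ^ 3 * 5 * eMod Lmod * ℓ then Real.log p / p else 0))) ∧
          -(1 / (2 * (ℓ : ℝ)) * (TateDivisorDatum.ofNFPointOver (Pt a c) {2, ℓ} F).logq) ≤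
            -(1 / (((ℓ : ℝ) - 1) / 2)) * (∑ p ∈ V, |vol p| + |volArch|) := by
  obtain ⟨F, _, _, _, K, _, _, _, _, _, _, ψ, hU, hF, hK, hq, Lmod, _, _, hmod, hdmod, DK, hDK, vol, volArch, hStepV, hLower⟩ :=
    genuineResidual_reading3_sat ha hc hsmall hℓ h7
  -- the reading-(3) set is an admissible `V^dst_ℚ` (p464392 §5, verbatim)
  refine ⟨F, inferInstance, inferInstance, inferInstance, K, inferInstance, inferInstance, inferInstance, inferInstance,
    inferInstance, inferInstance, ψ, hU, hF, hK, hq, Lmod, inferInstance, inferInstance, hmod, hdmod, _,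
    fun q hq' => ⟨GenuineVdst.prime_of_mem_reading3 (Pt a c) ℓ hq', GenuineVdst.threeWay_of_mem_reading3 (Pt a c) ℓ K hq'⟩,
    fun u hu => GenuineVdst.residueChar_mem_of_ramified ψ hU hF hℓ hK (GenuineVdst.hsupp_ofNFPoint_pair hℓ) u hu,
    fun w hw => ?_, DK, hDK, vol, volArch, hStepV, hLower⟩
  refine Finset.mem_union_left _ (Finset.mem_union_right _ (Finset.mem_image.mpr
    ⟨finBelow (Pt a c).F F w, (TateDivisorDatum.mem_ofNFPointOver_V_iff (P := Pt a c) (S := {2, ℓ}) F w).1 hw, ?_⟩))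
  exact residueChar_finBelow (F := (Pt a c).F) w

/-! ## 5. Admissibility audit at `(a, c, ℓ) = (1, 1, 17)`: every clause of the binder except (P6) -/

omit ha hc in
/-- `log q^∀(P_{1,1}) = log 5 + 2·log 7 ∈ [4, 16]`. [cite: Mochizuki2012, IUTchIV Cor 2.2 (i) p.41] -/
theorem logQForall_one_one_bounds : 4 ≤ logQForall (Pt 1 1) ∧ logQForall (Pt 1 1) ≤ 16 := by
  rw [logQForall_eq (a := 1) (c := 1) le_rfl le_rfl]
  have h5 : Real.log 5 ≤ 5 - 1 := Real.log_le_sub_one_of_pos (by norm_num)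
  have h7 : Real.log 7 ≤ 7 - 1 := Real.log_le_sub_one_of_pos (by norm_num)
  have h5' : 1 - (5 : ℝ)⁻¹ ≤ Real.log 5 := Real.one_sub_inv_le_log_of_pos (by norm_num)
  have h7' := log_seven_div_ge
  push_cast
  constructor <;> nlinarith

omit ha hc in
/-- **Every admissibility clause of the binder of `abc_of_genuineResidualSupport` except (P6) holds at `(d, P, ℓ) = (2, P_{1,1}, 17)`**:
`P_{1,1} ∈ U(Q̄)_{≤2}`; `IsLem587Prime 2 P_{1,1} 17` (Lemma 5.8.7's window `√Q ≤ 17 ≤ 10·δ·√Q·log(2δQ)` with `Q = log q^∀ = log 5 + 2·log 7 ∈ [4,16]`,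
`δ = 2¹²·3³·5·2`; (P2) `17 ∤ 2a, 2c`; the residue-`17` clause is vacuous since the poles lie over `5`, `7`); `7 ≤ 17`, (P2), (P5) — the
first three conjuncts of `ITDConditions P_{1,1} 17`; `AdmitsCore`; the Lemma-6.7.8 room `log(4·2¹²·3³·5·2·17) ≤ (4/3)·17`. The fourth
conjunct (P6) = `Cor22.CondP6 P_{1,1} 17` (`ρ̄_{E,17}(G_F) ⊇ SL₂(𝔽₁₇)` over every theta field) is NOT claimed: the tree discharges (P6) only
above the ineffective height `H_K` of `Cor22.condP6_of_seven_le`. So a FULLY admissible triple with an inhabited `∃`-body is not certified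
here — located, not claimed. [cite: Mochizuki2012, IUTchIV Cor 2.2 (ii) pp.45–46] [claim: Joshi2024ATS4, status: disputed] -/
theorem admissible_except_P6 :
    Pt 1 1 ∈ UPle 2 ∧ IsLem587Prime 2 (Pt 1 1) 17 ∧ (7 ≤ 17 ∧ CondP2 (Pt 1 1) 17 ∧ CondP5 (Pt 1 1) 17) ∧ AdmitsCore (Pt 1 1) ∧
      Real.log (4 * (2 ^ 12 * 3 ^ 3 * 5 * ((2 : ℕ) : ℝ)) * ((17 : ℕ) : ℝ)) ≤ 4 / 3 * ((17 : ℕ) : ℝ) := by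
  haveI : Fact (Nat.Prime 5) := ⟨by norm_num⟩
  haveI : Fact (Nat.Prime 7) := ⟨by norm_num⟩
  have h17 : (17 : ℕ).Prime := by norm_num
  have hP2 : CondP2 (Pt 1 1) 17 := condP2_P le_rfl le_rfl h17 (by norm_num) (by norm_num) (by norm_num)
  have hP5 : CondP5 (Pt 1 1) 17 := condP5_P le_rfl le_rfl h17 (by norm_num)
  obtain ⟨hQ4, hQ16⟩ := logQForall_one_one_bounds
  have hsq1 : 1 ≤ Real.sqrt (logQForall (Pt 1 1)) := Real.one_le_sqrt.mpr (by linarith)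
  have hsq17 : Real.sqrt (logQForall (Pt 1 1)) ≤ 17 := by
    rw [show (17 : ℝ) = Real.sqrt (17 ^ 2) from (Real.sqrt_sq (by norm_num)).symm]
    exact Real.sqrt_le_sqrt (by linarith)
  refine ⟨⟨P_mem_UP le_rfl le_rfl, (finrank_F 1 1).le⟩, ⟨h17, hsq17, ?_, hP2, ?_⟩, ⟨by norm_num, hP2, hP5⟩, admitsCore_P le_rfl le_rfl, ?_⟩
  · -- `17 ≤ 10·δ·√Q·log(2δQ)`: `δ = 2¹²·3³·5·2`, `√Q ≥ 1`, `log(2δQ) ≥ 1`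
    have hδ : delta 2 = 1105920 := by unfold delta; norm_num
    rw [hδ]
    have hlog : 1 ≤ Real.log (2 * 1105920 * logQForall (Pt 1 1)) := by
      rw [Real.le_log_iff_exp_le (by positivity)]
      have he := Real.exp_one_lt_d9
      linarith
    have hprod : 1 * 1 ≤ Real.sqrt (logQForall (Pt 1 1)) * Real.log (2 * 1105920 * logQForall (Pt 1 1)) :=
      mul_le_mul hsq1 hlog (by norm_num) (Real.sqrt_nonneg _)
    calc ((17 : ℕ) : ℝ) ≤ 10 * 1105920 * (1 * 1) := by norm_num
      _ ≤ 10 * 1105920 * (Real.sqrt (logQForall (Pt 1 1)) * Real.log (2 * 1105920 * logQForall (Pt 1 1))) :=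
          mul_le_mul_of_nonneg_left hprod (by norm_num)
      _ = 10 * 1105920 * Real.sqrt (logQForall (Pt 1 1)) * Real.log (2 * 1105920 * logQForall (Pt 1 1)) := by ring
  · -- the residue-`17` clause is vacuous: the poles of `j(λ_{1,1})` lie over `5`, `7`
    intro v hv hres
    exfalso
    have hneg : ord (SUnitFamily.F 1 1) v (jInv (lam 1 1)) < 0 := (mem_badPlaces_iff_ord_neg (Pt 1 1) v).mp hv
    rcases five_mem_or_seven_mem_of_ord_neg le_rfl hneg with h | h
    · have h5 : residueChar (Pt 1 1).F v = 5 := (mem_placesOver_iff_residueChar v).mp (mem_placesOver_of_natCast_mem 5 v h)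
      have h517 : (5 : ℕ) = 17 := h5.symm.trans hres
      omega
    · have h7 : residueChar (Pt 1 1).F v = 7 := (mem_placesOver_iff_residueChar v).mp (mem_placesOver_of_natCast_mem 7 v h)
      have h717 : (7 : ℕ) = 17 := h7.symm.trans hres
      omega
  · -- the Lemma-6.7.8 room at `d = 2`, `ℓ = 17`: `4·2¹²·3³·5·2·17 = 75202560 ≤ 2²⁷`
    have e : (4 * (2 ^ 12 * 3 ^ 3 * 5 * ((2 : ℕ) : ℝ)) * ((17 : ℕ) : ℝ)) = 75202560 := by norm_num
    have e' : (4 / 3 * ((17 : ℕ) : ℝ)) = 68 / 3 := by norm_num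
    rw [e, e']
    have h2 := Real.log_two_lt_d9
    calc Real.log 75202560 ≤ Real.log ((2 : ℝ) ^ 27) := Real.log_le_log (by norm_num) (by norm_num)
      _ = 27 * Real.log 2 := by rw [Real.log_pow]; norm_num
      _ ≤ 68 / 3 := by linarith

end SUnitResidual

end Summit.ABC.IUTFork.Joshi.ATS4

end
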